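import Summits.BirchSwinnertonDyer.Rank1Residual.Additive.X4SharpThreeKimConjectureOptimal
import Summits.BirchSwinnertonDyer.Rank1Residual.Additive.PlusSymbolIntegrality
import HarnessLib

/-!
# N11 modulo the announced Kim 2025 clause: the integrality hypothesis `hInt` of
# `X4SharpThreeKimConjectureOptimal.lean` DISCHARGED by p09's theorem (cell `b2b-bsdres`, seat
# additive-p4, GEN 18, line V35 part 2)

HONEST FRAMING (cell `b2b-bsdres`, run/shared/lean/b2b/bsd-rank1-residual/, verbatim in every
file): the goal of the cell is to DELETE the COMBINATION-SHAPED residual classes of the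
Birch–Swinnerton-Dyer formula for ALL analytic-rank `≤ 1` elliptic curves over `ℚ` — "full BSD
formula for every rank `≤ 1` curve in class `C`" assembled STRICTLY from published theorems — so
that the rank-`≤ 1` remainder becomes exactly the CONSTRUCTION-SHAPED classes, which are TYPED
(missing-input `Prop`s), NOT attempted. This is not "finishing BSD". Seat `additive-p4`: research
route on the CONSTRUCTION-SHAPED class X4 / N11; theorems only — no definition, no named fact
minted. EVERY theorem below stays CONDITIONAL on the ANNOUNCED Kim 2025 clause
`Kim2025.thm11_kimShaLength_of_integralPeriod_OPEN` (arXiv:2505.09121 Thm. 1.1, a PREPRINT, flag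
`Kim2025-preprint`; OPEN binder `hK25s`, never a theorem). N11's mark UNCHANGED; nothing booked.

## What this file proves

`X4SharpThreeKimConjectureOptimal.lean` (p255160) carried the `Ω⁺_f`-integrality of the plus symbols
on tower rows as ONE global hypothesis `hInt`, because n1011 p09's theorem
`Additive.forall_padicValRat_ratPlusSymbol_nonneg_of_towerSurj` (`PlusSymbolIntegrality.lean`,
p254396; T-R18b) was not yet built on the checking farm. Here `hInt` is DISCHARGED:

* `plusSymbolIntegralOnTowers_holds` — the hypothesis `hInt` IS p09's theorem (one line);
* `bsdp_iff_kimTamagawaDefectAt_of_optimal_of_kim2025_OPEN'` — on an OPTIMAL conductor-level datum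
  with `p ∤ c`, tower row, `p ≥ 3`: `BSD(E,p) ⟺ X4.KimTamagawaDefectAt W p D.f` — binders `hK25s`,
  GZK, modularity ONLY;
* `bsdp_iff_kimTamagawaDefectAt_isogenous_optimal_of_kim2025_OPEN'` — Conj. 1.10 at the OPTIMAL member
  decides `BSD(·,p)` for every member of a tower class (`hK25s`, Cassels, GZK, modularity);
* **`n11_rankZero_three_iff_kimTamagawaDefect_optimal_of_kim2025_OPEN'`** — THE N11 END STATE over
  optimal data on `hK25s` + Cassels + GZK + modularity and NOTHING ELSE: "`MissingPPartAt W 3` on every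
  X4 ∧ `r_an = 0` ∧ surj(3) pair" ⟺ (i) Conj. 1.10 at `3` on every optimal conductor-level datum with
  `3 ∤ c` of a tower curve ∧ (ii) `MissingPPartAt` on the tower classes with no strong datum prime to
  `3` ∧ (iii) `MissingPPartAt` on the EXOTIC pairs.

References: C.-H. Kim, arXiv:2505.09121 (2025) Thm. 1.1 [Kim2025RefinedTNC, ANNOUNCED]; C.-H. Kim,
Amer. J. Math. 148 (2026) Conj. 1.10 [Kim2022StructureSelmer]; Cassels 1965 [Cassels1965ArithmeticVIII];
Miller 2011 Def. 1.1 [Miller2011LMS]; Manin 1972 / Drinfeld 1973 via p09's file.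
-/

noncomputable section

open scoped Classical MatrixGroups ModularForm

open CongruenceSubgroup WeierstrassCurve Literature.NumberTheory.EllipticCurves
  Literature.NumberTheory.EllipticCurves.ModularForms
  Literature.NumberTheory.EllipticCurves.Rank1Residual
  Literature.NumberTheory.EllipticCurves.Rank1Residual.Typed

namespace Summit.BirchSwinnertonDyer.Rank1Residual.Additive

/-- **The integrality hypothesis `hInt` of the sibling file is p09's THEOREM** (`q ≠ 2`,
`IsNewformOf V g`, `ρ̄_{V,q^n}` onto ∀ `n` ⟹ `∀ r, [r]⁺_g ≠ 0 → 0 ≤ ord_q [r]⁺_g`: Drinfeld–Manin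
through an Eisenstein multiple prime to `q` at every cusp). [folklore] -/
theorem plusSymbolIntegralOnTowers_holds :
    ∀ (V : WeierstrassCurve ℚ) [V.IsElliptic] [V.IsGloballyMinimal] (q : ℕ) [Fact q.Prime]
      {M : ℕ} [NeZero M] (g : CuspForm (Gamma0 M) 2), q ≠ 2 → IsNewformOf V g →
      (∀ n : ℕ, V.HasSurjectiveModNGaloisRep (q ^ n : ℕ)) →
      ∀ r : ℚ, ratPlusSymbol g r ≠ 0 → 0 ≤ padicValRat q (ratPlusSymbol g r) :=
  by
  intro V _ _ q _ M _ g hq hg ht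
  exact forall_padicValRat_ratPlusSymbol_nonneg_of_towerSurj hq hg ht

section PerPair

variable (W : WeierstrassCurve ℚ) [W.IsElliptic] [W.IsGloballyMinimal] (p : ℕ) [hp : Fact p.Prime]

/-- **On an OPTIMAL conductor-level datum with `p ∤ c`, tower row, `p ≥ 3`: `BSD(E,p) ⟺
X4.KimTamagawaDefectAt W p D.f` modulo the preprint — binders `hK25s`, GZK, modularity only.**
[claim: Kim2025RefinedTNC, status: under-review] [cite: Kim2025RefinedTNC, Thm. 1.1 ("BSD") (ANNOUNCED, OPEN binder)]
[cite: Kim2022StructureSelmer, Conj. 1.10 (PDF p. 8), §1.3.5] [cite: Miller2011LMS, §1 and Def. 1.1] -/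
theorem bsdp_iff_kimTamagawaDefectAt_of_optimal_of_kim2025_OPEN'
    (hK25s : Kim2025.thm11_kimShaLength_of_integralPeriod_OPEN)
    (hGZK : rank_eq_analyticRank_of_analyticRank_le_one) (hmod : hasEntireLFunction_rat)
    (hp3 : 3 ≤ p) (hr : W.analyticRank = 0) (htower : ∀ n : ℕ, W.HasSurjectiveModNGaloisRep (p ^ n : ℕ))
    {N : ℕ} [NeZero N] (D : ModularParametrizationData W N)
    (hopt : ∀ z ∈ D.L.lattice, ∃ w ∈ periodLattice D.f, z = D.c * w)
    (hc : ¬ (p : ℤ) ∣ D.maninConstant) :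
    BSDp W p ↔ X4.KimTamagawaDefectAt W p D.f :=
  bsdp_iff_kimTamagawaDefectAt_of_optimal_of_kim2025_OPEN W p hK25s hGZK hmod
    plusSymbolIntegralOnTowers_holds hp3 hr htower D hopt hc

end PerPair

section ClassTransport

variable (W W₀ : WeierstrassCurve ℚ) [W.IsElliptic] [W.IsGloballyMinimal] [W₀.IsElliptic]
  [W₀.IsGloballyMinimal] (p : ℕ) [hp : Fact p.Prime]

/-- **Conj. 1.10 at an OPTIMAL ISOGENOUS member decides `BSD(W,p)` for every member of a tower class,
`p ≥ 3`, modulo the preprint — binders `hK25s`, Cassels, GZK, modularity only.**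
[claim: Kim2025RefinedTNC, status: under-review] [cite: Kim2025RefinedTNC, Thm. 1.1 ("BSD") (ANNOUNCED, OPEN binder)]
[cite: Kim2022StructureSelmer, Conj. 1.10 (PDF p. 8)] [cite: Cassels1965ArithmeticVIII] [cite: Miller2011LMS, §1 and Def. 1.1] -/
theorem bsdp_iff_kimTamagawaDefectAt_isogenous_optimal_of_kim2025_OPEN'
    (hK25s : Kim2025.thm11_kimShaLength_of_integralPeriod_OPEN) (hCassels : bsdRHS_eq_of_isIsogenous)
    (hGZK : rank_eq_analyticRank_of_analyticRank_le_one) (hmod : hasEntireLFunction_rat)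
    (hp3 : 3 ≤ p) (hr : W.analyticRank = 0) (hX : ClassX4 W p)
    (htower : ∀ n : ℕ, W.HasSurjectiveModNGaloisRep (p ^ n : ℕ))
    (hiso : IsIsogenous W₀ W) {N₀ : ℕ} [NeZero N₀] (D₀ : ModularParametrizationData W₀ N₀)
    (hopt₀ : ∀ z ∈ D₀.L.lattice, ∃ w ∈ periodLattice D₀.f, z = D₀.c * w)
    (hc₀ : ¬ (p : ℤ) ∣ D₀.maninConstant) :
    BSDp W p ↔ X4.KimTamagawaDefectAt W₀ p D₀.f :=
  bsdp_iff_kimTamagawaDefectAt_isogenous_optimal_of_kim2025_OPEN W W₀ p hK25s hCassels hGZK hmod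
    plusSymbolIntegralOnTowers_holds hp3 hr hX htower hiso D₀ hopt₀ hc₀

end ClassTransport

/-- **THE N11 END STATE over optimal data, modulo the announced Kim 2025 clause, on `hK25s` + Cassels
+ GZK + modularity and NOTHING ELSE** (the sibling's `…_optimal_of_kim2025_OPEN` with `hInt`
discharged). [claim: Kim2025RefinedTNC, status: under-review]
[cite: Kim2025RefinedTNC, Thm. 1.1 ("BSD") (ANNOUNCED, OPEN binder)] [cite: Kim2022StructureSelmer, Conj. 1.10 (PDF p. 8)]
[cite: Cassels1965ArithmeticVIII] [cite: Miller2011LMS, §1 and Def. 1.1] -/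
theorem n11_rankZero_three_iff_kimTamagawaDefect_optimal_of_kim2025_OPEN'
    (hK25s : Kim2025.thm11_kimShaLength_of_integralPeriod_OPEN) (hCassels : bsdRHS_eq_of_isIsogenous)
    (hGZK : rank_eq_analyticRank_of_analyticRank_le_one) (hmod : hasEntireLFunction_rat) :
    (∀ (W : WeierstrassCurve ℚ) [W.IsElliptic] [W.IsGloballyMinimal],
        W.analyticRank = 0 → ClassX4 W 3 → Surj W 3 → MissingPPartAt W 3) ↔
      (∀ (W : WeierstrassCurve ℚ) [W.IsElliptic] [W.IsGloballyMinimal],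
          W.analyticRank = 0 → ClassX4 W 3 → (∀ n : ℕ, W.HasSurjectiveModNGaloisRep (3 ^ n : ℕ)) →
          ∀ {N : ℕ} [NeZero N] (D : ModularParametrizationData W N), W.conductorNorm ℤ = N →
          (∀ z ∈ D.L.lattice, ∃ w ∈ periodLattice D.f, z = D.c * w) → ¬ (3 : ℤ) ∣ D.maninConstant →
          X4.KimTamagawaDefectAt W 3 D.f) ∧
      (∀ (W : WeierstrassCurve ℚ) [W.IsElliptic] [W.IsGloballyMinimal],
          W.analyticRank = 0 → ClassX4 W 3 → (∀ n : ℕ, W.HasSurjectiveModNGaloisRep (3 ^ n : ℕ)) →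
          (∀ (W₀ : WeierstrassCurve ℚ) [W₀.IsElliptic] [W₀.IsGloballyMinimal], IsIsogenous W₀ W →
            ∀ (N₀ : ℕ) [NeZero N₀] (D₀ : ModularParametrizationData W₀ N₀),
              W₀.conductorNorm ℤ ≠ N₀ ∨ (¬ ∀ z ∈ D₀.L.lattice, ∃ w ∈ periodLattice D₀.f, z = D₀.c * w) ∨
              (3 : ℤ) ∣ D₀.maninConstant) →
          MissingPPartAt W 3) ∧
      (∀ (W : WeierstrassCurve ℚ) [W.IsElliptic] [W.IsGloballyMinimal],
          W.analyticRank = 0 → ClassX4 W 3 → Surj W 3 →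
          ¬ (∀ n : ℕ, W.HasSurjectiveModNGaloisRep (3 ^ n : ℕ)) → MissingPPartAt W 3) :=
  n11_rankZero_three_iff_kimTamagawaDefect_optimal_of_kim2025_OPEN hK25s hCassels hGZK hmod
    plusSymbolIntegralOnTowers_holds

end Summit.BirchSwinnertonDyer.Rank1Residual.Additive

end
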